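import Literature.IUT.LogVolume.ExplicitEstimatesTheorem54
import Literature.IUT.LogVolume.Corollary22PartIILemmas
import HarnessLib

/-!
# [ExpEst] Theorem 5.3 (i) FROM Corollary 5.2 (mono-complex part): Remark 1.10.1 and "the various definitions involved"

S. Mochizuki, I. Fesenko, Y. Hoshi, A. Minamide, W. Porowski, *Explicit estimates in inter-universal
Teichmüller theory*, Kodai Math. J. **45** (2022) 175–236 — [ExpEst], bib key `MochizukiEtAl2022` (D-0012
claim key, status disputed). **Theorem 5.3, proof of (i)** (p. 220 = pdf p46.l8–10 of the cell render
`run/shared/lean/pub/abc-iut/plan/repair/lit/renders/MFHMP-ExplicitEstimates-Kodai2022-book-anonnd-eeiutp`):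
"assertion (i) follows immediately from Corollary 5.2 [cf. the bound on the restriction of the function
`log(𝔮^∀_{(−)})` to `𝔈𝔵𝔠^mcx_{d,ε}`; the displayed inequality of (C2)], Remark 1.10.1, and the various definitions
involved"; **Remark 1.10.1** (p. 193 = pdf p19.l7–11): "`h_non(j(E)) = log(𝔮^∀_{x_E})`".

PROOF-ONLY file (cell abc-iut, seat lit-abc-explicitiut gen 3): no definition, no named fact. TAKES NO SIDE on
[IUTchIII] Corollary 3.12 or on any author; typed ≠ proved ≠ endorsed; no abc claim. What is PROVED:

* `logQForall_eq_hNon` — **Remark 1.10.1** in the tree's vocabulary: for every point `P = (F, λ)` of the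
  `λ`-line, `Cor22.logQForall P = ExpEst.hNon (j(λ))` (`log(𝔮^∀)` = normalised degree of the `q`-parameter
  divisor `Σ_v max{0, −ord_v j}·[v]`, [IUTchIV] Cor. 2.2 / `Corollary22Statement.lean`; `h_non` = [ExpEst]
  Def. 1.1 (i); per place `log⁺‖j‖_v = max{0, −ord_v(j)}·log N(v)`, `posLog_finitePlace_mk`).
* `logDiff_mk`, `logCond_mk_legendre` — "the various definitions involved": for the point `x_E = (L, λ = −a/c)`
  of `E_{a,b,c}`, `log-diff_X(x_E) = (1/d)·log Δ_L` ([GenEll] Def. 1.5 (iii), `NFPoint.logDiff_eq_log_discr`) and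
  `log-cond_D(x_E) = (1/d)·log rad_L(a,b,c)` ([GenEll] Def. 1.5 (iv) via `NFPoint.condSupport_eq_badPrimes`:
  the support of the conductor of `λ` at `[0]+[1]+[∞]` is `I_L(λ, 1−λ, 1) = I_L(a, b, c)`).
* `thm53i_of_partMcx` — **Theorem 5.3 (i) from Corollary 5.2** (`ExpEst.PartMcx d ε`, the claim-tagged
  candidate of `ExplicitEstimatesCorollary52.lean`) for every mono-complex `L` and every `a, b, c` such that
  `L = ℚ(a/c)` is the minimal field of definition of `x_E` (`NFPoint.IsMinimal`; this is how
  `U_X(ℚ̄)^{≤d}` is presented in the tree, [GenEll] Def. 1.5 (i)). SPECIAL CASE, declared: when `ℚ(a/c) ⊊ L`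
  the printed derivation runs through the point presented over `F_min = ℚ(a/c)` and needs the comparison
  `log-diff + log-cond` over `F_min` versus `(1/[L:ℚ])·log(Δ_L·rad_L)` (ramified bad primes move from
  `rad` to `Δ`; [GenEll] §1) — `TODO(general form)`, not in this file.
* `isMinimal_rat`, `thm53i_rat_of_partMcx`, `IUTDisputedClaim_of_partMcx` — over `L = ℚ` minimality is
  automatic, so **`(∀ ε ∈ (0,1], PartMcx 1 ε) → Thm53i ℚ a b c ε` for all `a, b, c, ε`, hence `→ Theorem B`
  (`Literature.Barriers.ABC.IUTDisputedClaim`, via `ExpEst.IUTDisputedClaim_of_thm53i`)**: the whole printed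
  chain Cor. 5.2 ⟹ Thm. 5.3 (i) ⟹ Thm. 5.4 ⟹ Thm. B (⟹ Cor. 5.8/5.9, `IUTDisputedClaim*.lean`) is now a
  kernel-checked implication from the single claim-tagged hypothesis "Corollary 5.2 (mcx, d = 1)", itself
  printed as a consequence of Theorem 5.1, i.e. of the disputed μ₆-version of [IUTchIII] Corollary 3.12.
-/

noncomputable section

open scoped Classical

namespace Literature.IUT.LogVolume

namespace ExpEst

open NumberField IsDedekindDomain Real Cor22
open Literature.NumberTheory.DiophantineGeometry Literature.NumberTheory.DiophantineGeometry.GenEll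

/-! ## 1. Remark 1.10.1: `log(𝔮^∀_{x}) = h_non(j(x))` -/

section PerPlace

variable {F : Type*} [Field F] [NumberField F]

/-- Per place: `log⁺‖x‖_v = max{0, −ord_v(x)}·log N(v)` for `x ≠ 0` (`‖x‖_v = N(v)^{−ord_v(x)}`,
`ArakelovDivisors.adicAbv_eq_absNorm_zpow`) — the local content of Remark 1.10.1 ("`deg_v` of the `q`-parameter
divisor" = "local contribution to `h_non(j)`"). [cite: MochizukiEtAl2022, Rmk 1.10.1 p. 193] -/
theorem posLog_finitePlace_mk (v : HeightOneSpectrum (𝓞 F)) {x : F} (hx : x ≠ 0) :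
    log⁺ ((FinitePlace.mk v) x) = ((-(ord F v x)).toNat : ℝ) * logNorm F v := by
  rw [FinitePlace.mk_apply, FinitePlace.norm_embedding, adicAbv_eq_absNorm_zpow F v hx]
  have hN : 1 < (Ideal.absNorm v.asIdeal : ℝ) :=
    (Real.log_pos_iff (by positivity)).mp (logNorm_pos F v)
  rcases le_or_gt 0 (ord F v x) with hn | hn
  · have h1 : (Ideal.absNorm v.asIdeal : ℝ) ^ (-ord F v x) ≤ 1 := by
      rw [zpow_neg]; exact inv_le_one_of_one_le₀ (one_le_zpow₀ hN.le hn)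
    rw [(posLog_eq_zero_iff _).mpr (by rwa [abs_of_nonneg (by positivity)]),
      Int.toNat_eq_zero.mpr (by omega)]
    simp
  · have h1 : 1 ≤ (Ideal.absNorm v.asIdeal : ℝ) ^ (-ord F v x) := one_le_zpow₀ hN.le (by omega)
    rw [posLog_eq_log (by rwa [abs_of_nonneg (by positivity)]), Real.log_zpow]
    have : ((-ord F v x).toNat : ℝ) = ((-ord F v x : ℤ) : ℝ) := by
      exact_mod_cast Int.toNat_of_nonneg (by omega)
    rw [this, logNorm]

end PerPlace

/-- **[ExpEst] Remark 1.10.1** (p. 193: "it follows immediately from Definition 1.1 (i); Proposition 1.8 (i);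
[GenEll] Remark 3.3.1; [GenEll] Proposition 3.4; [Silv1] Chapter VII Proposition 5.5, that we have an equality
`h^{S-tor}_non − log(𝔮^∀_{(−)}) = h_non(j_E) − log(𝔮^∀_{(−)}) + ξ'` — where `h_non(j_E) = log(𝔮^∀_{(−)})`"), in the
tree's rendering of `log(𝔮^∀)` (`Cor22.logQForall`: the normalised degree of `Σ_v max{0, −ord_v j(λ)}·[v]`,
[IUTchIV] Cor. 2.2 (i) / [GenEll] Def. 3.3) and of `h_non` ([ExpEst] Def. 1.1 (i), `ExpEst.hNon`): for every
point `P = (F, λ)`, `log(𝔮^∀_P) = h_non(j(λ))`. [cite: MochizukiEtAl2022, Rmk 1.10.1 p. 193] -/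
theorem logQForall_eq_hNon (P : NFPoint) : logQForall P = hNon (jInv P.x) := by
  classical
  by_cases hj : jInv P.x = 0
  · rw [logQForall_eq_zero_of_jInv_zero_or_1728 (Or.inl hj), hj]
    unfold hNon
    simp
  · have hdeg : (0 : ℝ) < P.degree := by exact_mod_cast P.degree_pos
    apply mul_left_cancel₀ hdeg.ne'
    unfold logQForall
    rw [degree_mul_logQAvoid, Finset.filter_true_of_mem (fun v _ => by simp)]
    unfold hNon NFPoint.degree
    rw [← mul_assoc, mul_inv_cancel₀ (by exact_mod_cast Module.finrank_pos.ne'), one_mul,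
      ← finsum_comp_equiv FinitePlace.equivHeightOneSpectrum.symm]
    have key : ∀ v : HeightOneSpectrum (𝓞 P.F),
        log⁺ ((FinitePlace.equivHeightOneSpectrum.symm v) (jInv P.x)) =
          localHeight P v * logNorm P.F v :=
      fun v => posLog_finitePlace_mk v hj
    rw [finsum_congr key, finsum_eq_sum_of_support_subset _ ?_]
    intro v hv
    rw [Finset.mem_coe, mem_badPlaces_iff_ord_neg]
    rw [Function.mem_support] at hv
    by_contra hge
    apply hv
    rw [localHeight, Int.toNat_eq_zero.mpr (by omega)]
    simp

/-! ## 2. "The various definitions involved": `log-diff` and `log-cond` of `x_E` -/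

/-- `log-diff_X((L, λ)) = (1/[L:ℚ])·log Δ_L` ([GenEll] Def. 1.5 (iii); the tree's `NFPoint.logDiff_eq_log_discr`,
`ExpEst.absDisc`). [cite: MochizukiEtAl2022, Thm 5.3 (i) proof p. 220] -/
theorem logDiff_mk (L : Type) [Field L] [NumberField L] (t : L) :
    (NFPoint.mk L t).logDiff = (Module.finrank ℚ L : ℝ)⁻¹ * Real.log (absDisc L) := by
  rw [NFPoint.logDiff_eq_log_discr]
  rfl

section BadPrimes

variable {K : Type*} [Field K] [NumberField K]

/-- `I_K` is projective: invariant under scaling by a nonzero constant. [folklore] -/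
private theorem badPrimes_mul_left {c : K} (hc : c ≠ 0) (x y z : K) :
    badPrimes (c * x) (c * y) (c * z) = badPrimes x y z := by
  ext v
  have hvc : v.valuation K c ≠ 0 := (Valuation.ne_zero_iff _).mpr hc
  simp only [badPrimes, Set.mem_setOf_eq, map_mul, mul_right_inj' hvc]

/-- `I_K` ignores signs of the first two entries. [folklore] -/
private theorem badPrimes_neg_neg (x y z : K) : badPrimes (-x) (-y) z = badPrimes x y z := by
  ext v; simp only [badPrimes, Set.mem_setOf_eq, Valuation.map_neg]

/-- For `a + b + c = 0`, `abc ≠ 0`: the support of the conductor of `λ = −a/c` at `[0]+[1]+[∞]`, i.e.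
`I_K(λ, 1 − λ, 1)`, is `I_K(a, b, c)` (`1 − λ = −b/c`; projectivity). [cite: MochizukiEtAl2022, Thm 5.3 p. 219] -/
theorem badPrimes_legendre {a b c : K} (hc : c ≠ 0) (h : a + b + c = 0) :
    badPrimes (-(a / c)) (1 - -(a / c)) 1 = badPrimes a b c := by
  have hb' : b = -(a + c) := by linear_combination h
  have e1 : 1 - -(a / c) = -(b / c) := by rw [hb']; field_simp; ring
  rw [e1, badPrimes_neg_neg, ← badPrimes_mul_left hc (a / c) (b / c) 1, mul_div_cancel₀ a hc,
    mul_div_cancel₀ b hc, mul_one]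

end BadPrimes

/-- `log-cond_D((L, −a/c)) = (1/[L:ℚ])·log rad_L(a,b,c)` for `a + b + c = 0`, `abc ≠ 0` ([GenEll] Def. 1.5 (iv),
`NFPoint.logCond`, `NFPoint.condSupport_eq_badPrimes`; `rad_L = radicalNorm`, `ExpEst.radL_eq_radicalNorm`).
[cite: MochizukiEtAl2022, Thm 5.3 (i) proof p. 220] -/
theorem logCond_mk_legendre {L : Type} [Field L] [NumberField L] {a b c : L} (hc : c ≠ 0)
    (h : a + b + c = 0) :
    (NFPoint.mk L (-(a / c))).logCond = (Module.finrank ℚ L : ℝ)⁻¹ * Real.log (radL a b c) := by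
  unfold NFPoint.logCond
  rw [NFPoint.condSupport_eq_badPrimes, radL_eq_radicalNorm]
  show (Module.finrank ℚ L : ℝ)⁻¹ * _ = _
  rw [badPrimes_legendre hc h]
  rfl

/-! ## 3. Theorem 5.3 (i) from Corollary 5.2 -/

/-- **[ExpEst] Theorem 5.3 (i) FROM Corollary 5.2 (mono-complex part)**, for points whose minimal field of
definition is `L` (p. 220: "assertion (i) follows immediately from Corollary 5.2 [… the restriction of
`log(𝔮^∀)` to `𝔈𝔵𝔠^mcx_{d,ε}`; … (C2)], Remark 1.10.1, and the various definitions involved"): if `PartMcx [L:ℚ] ε`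
holds and `ℚ(a/c) = L`, then `Thm53i L a b c ε`. Off `𝔈𝔵𝔠`: (C2) `(1/6)·log(𝔮^∀) ≤ (1+ε)(log-diff + log-cond)` with
§§1–2; on `𝔈𝔵𝔠`: `log(𝔮^∀) ≤ h_d(ε)`. SPECIAL CASE `ℚ(a/c) = L` (see the module docstring for the general case).
An IMPLICATION between typed candidates; neither side asserted. [cite: MochizukiEtAl2022, Thm 5.3 (i) proof p. 220] -/
theorem thm53i_of_partMcx {L : Type} [Field L] [NumberField L] {a b c : L} {ε : ℝ}
    (hmin : (NFPoint.mk L (-(a / c))).IsMinimal) (H : PartMcx (Module.finrank ℚ L) ε) :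
    Thm53i L a b c ε := by
  intro hL ha hb hc hsum _hε _hε1
  obtain ⟨Exc, -, -, -, hExc, hC⟩ := H
  set P : NFPoint := NFPoint.mk L (-(a / c)) with hP
  have h0 : -(a / c) ≠ 0 := neg_ne_zero.mpr (div_ne_zero ha hc)
  have h1 : -(a / c) ≠ 1 := by
    intro h1
    apply hb
    have : a = -c := by field_simp at h1; linear_combination -h1
    linear_combination hsum - this
  have hPU : P ∈ UPle (Module.finrank ℚ L) := ⟨⟨⟨h0, h1⟩, hmin⟩, le_rfl⟩
  have hmcx : IsMonoComplex P.F := hL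
  have h110 : logQForall P = hNon (jInv (-(a / c))) := logQForall_eq_hNon P
  by_cases hE : P ∈ Exc
  · have hq := hExc P hE
    rw [h110] at hq
    calc 1 / 6 * hNon (jInv (-(a / c))) ≤ 1 / 6 * hd (Module.finrank ℚ L) ε := by linarith
      _ ≤ _ := le_max_right _ _
  · obtain ⟨l, -, -, hC2⟩ := hC P hPU hmcx hE
    unfold ConditionC2 at hC2
    rw [h110, hP, logDiff_mk, logCond_mk_legendre hc hsum] at hC2
    have hΔ : (0 : ℝ) < (absDisc L : ℝ) := by
      unfold absDisc; exact_mod_cast Int.natAbs_pos.mpr (NumberField.discr_ne_zero L)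
    have hR : (0 : ℝ) < (radL a b c : ℝ) := by exact_mod_cast one_le_radL a b c
    calc 1 / 6 * hNon (jInv (-(a / c)))
        ≤ (1 + ε) * ((Module.finrank ℚ L : ℝ)⁻¹ * Real.log (absDisc L) +
            (Module.finrank ℚ L : ℝ)⁻¹ * Real.log (radL a b c)) := hC2
      _ = (Module.finrank ℚ L : ℝ)⁻¹ * (1 + ε) * Real.log ((absDisc L : ℝ) * (radL a b c : ℝ)) := by
          rw [Real.log_mul hΔ.ne' hR.ne']; ring
      _ ≤ _ := le_max_left _ _

/-! ## 4. Over `ℚ`: Corollary 5.2 ⟹ Theorem 5.3 (i) ⟹ Theorem B, unconditionally in `a, b, c` -/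

/-- Over `ℚ` every point is minimally presented: `ℚ(x) = ℚ`. [cite: MochizukiGenEll2010, Def 1.5 (i) p.8] -/
theorem isMinimal_rat (x : ℚ) : (NFPoint.mk ℚ x).IsMinimal := by
  unfold NFPoint.IsMinimal
  rw [eq_top_iff]
  intro y _
  have key : ∀ K : IntermediateField ℚ (NFPoint.mk ℚ x).F, y ∈ K := fun K => by
    simpa [Subsingleton.elim (algebraMap ℚ (NFPoint.mk ℚ x).F) (RingHom.id ℚ)] using K.algebraMap_mem y
  exact key _

/-- **Corollary 5.2 (mcx, `d = 1`) ⟹ Theorem 5.3 (i) over `ℚ`**, for all `a, b, c ∈ ℚ^×` with `a + b + c = 0` and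
all `ε` (the hypotheses live inside `Thm53i`). [cite: MochizukiEtAl2022, Thm 5.3 (i) proof p. 220] -/
theorem thm53i_rat_of_partMcx (H : ∀ ε : ℝ, 0 < ε → ε ≤ 1 → PartMcx 1 ε) (a b c : ℚ) (ε : ℝ) :
    Thm53i ℚ a b c ε := by
  intro hL ha hb hc hsum hε hε1
  have H' : PartMcx (Module.finrank ℚ ℚ) ε := by
    rw [Module.finrank_self]; exact H ε hε hε1
  exact thm53i_of_partMcx (isMinimal_rat _) H' hL ha hb hc hsum hε hε1

/-- **Corollary 5.2 (mcx, `d = 1`) ⟹ Theorem B** ([ExpEst] Thm. 5.4 at `L = ℚ`, the tree's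
`Literature.Barriers.ABC.IUTDisputedClaim`): composition of `thm53i_rat_of_partMcx` with
`ExpEst.IUTDisputedClaim_of_thm53i` (`ExplicitEstimatesTheorem54.lean`). So every printed consequence of
Corollary 5.2 in [ExpEst] §5 over `ℚ` (Thm. 5.3 (i), Thm. 5.4 = Thm. B, Cor. 5.8, Cor. 5.9 via
`IUTDisputedClaimProofs.lean`) is a kernel-checked implication from this one claim-tagged candidate; the
candidate itself is NOT asserted (its printed proof is Theorem 5.1, i.e. the disputed μ₆-[IUTchIII] Cor. 3.12).
[cite: MochizukiEtAl2022, Thm 5.4 proof p. 221–222] -/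
theorem IUTDisputedClaim_of_partMcx (H : ∀ ε : ℝ, 0 < ε → ε ≤ 1 → PartMcx 1 ε) :
    Literature.Barriers.ABC.IUTDisputedClaim :=
  IUTDisputedClaim_of_thm53i fun a b c ε => thm53i_rat_of_partMcx H a b c ε

end ExpEst

end Literature.IUT.LogVolume

end
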